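import Mathlib
import Literature.Analysis.FluidPDE.CheskidovFriedlander2009.VanishingViscosityLimit
import HarnessLib

/-!
# Cheskidov–Friedlander–Pavlović 2010, §4: Onsager's dichotomy for the forced inviscid dyadic
# model — energy equality for `H^{5/6}`-regular solutions, finite-time blow-up in `H^{5/6}` of every
# solution, and local integrability of the subcritical norms

Statement layer (typed, page-confirmed on arXiv:math/0610815v1, PDF pages) for §4 of
A. Cheskidov, S. Friedlander, N. Pavlović, *An inviscid dyadic model of turbulence: the global
attractor*, Discrete Contin. Dyn. Syst. 26 (2010) 781–794, complementing
`CheskidovFriedlanderPavlovic2010_thm44` (the exponential global attractor) in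
`VanishingViscosityLimit.lean`, whose vocabulary is used: the model (1.2) there at `ν = 0`,
`c = 5/2` (`λ = 2^{5/2}`), force `f₀ > 0` on the first shell (`rhs`, `force`, `IsSolution` =
CFP Def. 3.1 p. 4, `normSq` = `|·|²`). Norms (2.2), p. 3: `‖u‖²_s = Σ_j 2^{2sj}u_j²` (`hsNormSq`,
extended-real valued); the critical space is `H^{5/6}` ("a regular solution … a solution with
bounded `H^{5/6}` norm", p. 2).

* **Thm. 4.3**, p. 10: "Let `a(t)` be a solution of (1.2) with the initial data `a(0) ∈ l²`,
  `a_j(0) ≥ 0`. Then `‖a(t)‖²_s` is locally integrable on `[0,∞)` for all `s < 5/6`."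
  → `CheskidovFriedlanderPavlovic2010_thm43`.
* **Thm. 4.5**, p. 11 (energy equality — the rigid side): "Let `a(t)` be a solution of (1.2) for
  which `‖a(t)‖³_{5/6}` is integrable on some interval `[T₁,T₂]`. Then `a(t)` satisfies the energy
  equality `|a(t)|² = |a(t₀)|² + 2∫_{t₀}^t (f,a(τ))dτ` (4.35) for all `T₁ ≤ t₀ ≤ t ≤ T₂`"
  (printed "`≤ T`"). → `CheskidovFriedlanderPavlovic2010_thm45`.
* **Cor. 4.6**, p. 11 (blow-up — the flexible side, for EVERY solution): "Let `a(t)` be a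
  solution of (1.2) with `a_j(0) ≥ 0`. Then `‖a(t)‖³_{5/6}` is not locally integrable on `[0,∞)`.
  In particular, `‖a(t)‖_{5/6}` blows up in finite time." → `CheskidovFriedlanderPavlovic2010_cor46`
  ("not locally integrable on `[0,∞)`" read, as for the tree's `Cheskidov2008_thm53`, as: on some
  bounded `[0,T]` the lower integral of `(‖a(t)‖²_{5/6})^{3/2}` is infinite; the "in particular"
  clause follows and is not typed separately).

Integrability of `‖a(t)‖³_{5/6} = (‖a(t)‖²_{5/6})^{3/2}` and of `‖a(t)‖²_s` is transcribed with lower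
Lebesgue integrals of the `[0,∞]`-valued norms over `Icc`; `(f, a(τ)) = f₀a₀(τ)`. All three are
named facts (proofs pp. 6–12 via the telescoping variables `d_j` of (4.2), Thm. 4.2 there, and —
for Cor. 4.6 — the attractor Thm. 4.4; not reproduced). Standing data hypotheses as printed
(Thm. 4.5 carries no sign condition). Not typed: Thm. 4.2 (the `d_j`-dissipation inequality
(4.28)), §5 (evolutionary systems, Thm. 5.4 `𝒜_s = 𝒜_w = {fixed point}` — its content for solutions
is Thm. 4.4), §6 (Kolmogorov spectrum of the fixed point, a computation).
-/

noncomputable section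

open Set MeasureTheory
open scoped ENNReal BigOperators

namespace Literature.Analysis.FluidPDE.CheskidovFriedlander2009

/-- The squared Sobolev norm `‖u‖²_s = Σ_j 2^{2sj}u_j²` of CFP 2010 (2.2) (= Cheskidov–Friedlander
2009 p. 3), valued in `[0,∞]`; `s = 1` agrees with `h1NormSq` (`2^{2·1·j} = 2^{2j}`).
[cite: CheskidovFriedlanderPavlovic2010, §2 (2.2) p.3] -/
def hsNormSq (s : ℝ) (u : ℕ → ℝ) : ℝ≥0∞ :=
  ∑' j : ℕ, ENNReal.ofReal ((2 : ℝ) ^ (2 * s * (j : ℝ)) * u j ^ 2)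

/-- `hsNormSq 1 = h1NormSq`. [cite: CheskidovFriedlanderPavlovic2010, §2 (2.2) p.3] -/
theorem hsNormSq_one (u : ℕ → ℝ) : hsNormSq 1 u = h1NormSq u := by
  unfold hsNormSq h1NormSq
  refine tsum_congr fun j => ?_
  rw [show (2 : ℝ) * 1 * (j : ℝ) = ((2 * j : ℕ) : ℝ) by push_cast; ring, Real.rpow_natCast]

/-- **Cheskidov–Friedlander–Pavlović 2010, Theorem 4.3** (subcritical norms are locally
integrable), as printed, p. 10: "Let `a(t)` be a solution of (1.2) with the initial data
`a(0) ∈ l²`, `a_j(0) ≥ 0`. Then `‖a(t)‖²_s` is locally integrable on `[0,∞)` for all `s < 5/6`."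
Model (1.2) = `IsSolution (5/2) 0 (force f₀)`, `f₀ > 0`; transcription: for every `T ≥ 0` the
lower integral of `‖a(t)‖²_s` over `[0,T]` is finite. Named fact (proof p. 10 from Thm. 4.2 there
and (4.29); not reproduced). [cite: CheskidovFriedlanderPavlovic2010, Thm 4.3 p.10] -/
def CheskidovFriedlanderPavlovic2010_thm43 : Prop :=
  ∀ f₀ : ℝ, 0 < f₀ → ∀ a : ℕ → ℝ → ℝ, IsSolution (5 / 2) 0 (force f₀) a → (∀ j, 0 ≤ a j 0) →
    ∀ s : ℝ, s < 5 / 6 → ∀ T : ℝ, 0 ≤ T →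
      ∫⁻ t in Icc (0 : ℝ) T, hsNormSq s (fun j => a j t) < ⊤

/-- **Cheskidov–Friedlander–Pavlović 2010, Theorem 4.5** (energy equality for `H^{5/6}`-regular
solutions — Onsager's rigid side for the dyadic model), as printed, p. 11: "Let `a(t)` be a
solution of (1.2) for which `‖a(t)‖³_{5/6}` is integrable on some interval `[T₁,T₂]`. Then `a(t)`
satisfies the energy equality `|a(t)|² = |a(t₀)|² + 2∫_{t₀}^t (f,a(τ))dτ` (4.35), for all
`T₁ ≤ t₀ ≤ t ≤ T₂`." Model (1.2) = `IsSolution (5/2) 0 (force f₀)` with its standing `f₀ > 0` (no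
sign condition on the solution); solutions live on `[0,∞)`, so `0 ≤ T₁`; `(f,a(τ)) = f₀a₀(τ)`;
`‖a‖³_{5/6} = (‖a‖²_{5/6})^{3/2}` integrable = finite lower integral over `[T₁,T₂]`. Named fact
(proof p. 11: `ℓ^{3/2} ⊂ ℓ¹` on `h_j = λ^{2j/3}a_j²` kills the flux `λ^N a_N²a_{N+1}` in the truncated
energy balance (3.10); not reproduced). [cite: CheskidovFriedlanderPavlovic2010, Thm 4.5 p.11] -/
def CheskidovFriedlanderPavlovic2010_thm45 : Prop :=
  ∀ f₀ : ℝ, 0 < f₀ → ∀ a : ℕ → ℝ → ℝ, IsSolution (5 / 2) 0 (force f₀) a →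
    ∀ T₁ T₂ : ℝ, 0 ≤ T₁ → T₁ ≤ T₂ →
      ∫⁻ t in Icc T₁ T₂, hsNormSq (5 / 6) (fun j => a j t) ^ (3 / 2 : ℝ) < ⊤ →
        ∀ t₀ t : ℝ, T₁ ≤ t₀ → t₀ ≤ t → t ≤ T₂ →
          normSq (fun j => a j t) = normSq (fun j => a j t₀) + 2 * ∫ τ in t₀..t, f₀ * a 0 τ

/-- **Cheskidov–Friedlander–Pavlović 2010, Corollary 4.6** (finite-time blow-up in `H^{5/6}` of
EVERY solution — Onsager's flexible side for the dyadic model), as printed, p. 11: "Let `a(t)` be a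
solution of (1.2) with `a_j(0) ≥ 0`. Then `‖a(t)‖³_{5/6}` is not locally integrable on `[0,∞)`. In
particular, `‖a(t)‖_{5/6}` blows up in finite time." Model (1.2) = `IsSolution (5/2) 0 (force f₀)`,
`f₀ > 0`; "not locally integrable on `[0,∞)`" transcribed as: for some bounded `[0,T]` the lower
integral of `(‖a(t)‖²_{5/6})^{3/2}` is infinite (the reading used for the tree's
`Cheskidov2008_thm53`; the "in particular" clause — `‖a(t)‖_{5/6}` unbounded on `[0,T]` — follows
and is not typed separately). Named fact (proof pp. 11–12 from Thms. 4.4, 4.5; not reproduced).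
[cite: CheskidovFriedlanderPavlovic2010, Cor 4.6 p.11] -/
def CheskidovFriedlanderPavlovic2010_cor46 : Prop :=
  ∀ f₀ : ℝ, 0 < f₀ → ∀ a : ℕ → ℝ → ℝ, IsSolution (5 / 2) 0 (force f₀) a → (∀ j, 0 ≤ a j 0) →
    ∃ T : ℝ, 0 < T ∧ ∫⁻ t in Icc (0 : ℝ) T, hsNormSq (5 / 6) (fun j => a j t) ^ (3 / 2 : ℝ) = ⊤

/-- The dichotomy in one line: under Cor. 4.6 no solution from a non-negative `ℓ²` datum keeps
`‖a(t)‖³_{5/6}` integrable on every bounded interval — in particular the inviscid fixed point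
`α⁰ ∉ H^{5/6}` (CFP p. 2 (a)), since the constant solution `a ≡ α⁰` would otherwise have finite
integrals `T·(‖α⁰‖²_{5/6})^{3/2}`. Proved from the named fact.
[cite: CheskidovFriedlanderPavlovic2010, Cor 4.6 p.11 and §1 p.2 (a)] -/
theorem CheskidovFriedlanderPavlovic2010_cor46.inviscidFixedPoint_not_mem_H56
    (h : CheskidovFriedlanderPavlovic2010_cor46) {f₀ : ℝ} (hf : 0 < f₀) :
    hsNormSq (5 / 6) (inviscidFixedPoint (5 / 2) f₀) = ⊤ := by
  have hfix := isFixedPoint_inviscidFixedPoint (c := 5 / 2) (f₀ := f₀) (by norm_num) hf.le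
  obtain ⟨T, hT, hint⟩ := h f₀ hf (fun j _ => inviscidFixedPoint (5 / 2) f₀ j) hfix.isSolution
    (fun j => (inviscidFixedPoint_pos (5 / 2) hf j).le)
  -- the integrand is the constant `(‖α⁰‖²_{5/6})^{3/2}`; a finite constant has a finite integral
  by_contra hne
  have hlt : hsNormSq (5 / 6) (inviscidFixedPoint (5 / 2) f₀) ^ (3 / 2 : ℝ) < ⊤ :=
    ENNReal.rpow_lt_top_of_nonneg (by norm_num) hne
  have hconst : ∫⁻ _ in Icc (0 : ℝ) T, hsNormSq (5 / 6) (inviscidFixedPoint (5 / 2) f₀) ^ (3 / 2 : ℝ)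
      = hsNormSq (5 / 6) (inviscidFixedPoint (5 / 2) f₀) ^ (3 / 2 : ℝ) * volume (Icc (0 : ℝ) T) := by
    rw [lintegral_const, Measure.restrict_apply MeasurableSet.univ, univ_inter]
  have hvol : volume (Icc (0 : ℝ) T) < ⊤ := by
    rw [Real.volume_Icc]
    exact ENNReal.ofReal_lt_top
  have hfin : ∫⁻ _ in Icc (0 : ℝ) T,
      hsNormSq (5 / 6) (inviscidFixedPoint (5 / 2) f₀) ^ (3 / 2 : ℝ) < ⊤ := by
    rw [hconst]
    exact ENNReal.mul_lt_top hlt hvol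
  exact absurd hint hfin.ne

end Literature.Analysis.FluidPDE.CheskidovFriedlander2009

end
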